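import Summits.ResolutionOfSingularities.ResolutionOfSingularities.Theorems.HilbertSamuelEliminationSigmaMaxModificationsCorridor3WLadderIsoTailsHSArc
import Literature.RingTheory.HilbertSamuel.NormalFlatnessHilbertFunction
import HarnessLib

/-!
# [OURS · L1 W4.2] D14 ROUTE G — the GENERAL ARC END (G1b-α): a regular arc along which the local ring is normally flat lies in
# the Hilbert–Samuel stratum of the closed point, so the closed point is NOT isolated in the Hilbert–Samuel locus

Cell res-hironaka, rung L, slot W4.2 (crux `SigmaMaxModificationsCorridor3`, stmt-ResolutionOfSingularities-19249); row
`stub_WtopRecIsoM_pointed`, KERNEL K1 `IsoFreeRationalTailsImpossible`, res-L1-w42-lead-1's D14 BRIDGE CUT, ROUTE G (general stages,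
`edim ≥ 5`). This is the embedding-dimension-free twin of H7 (`…IsoTailsHSArc.not_isIsolatedInHSMaxLocus_closedPoint_of_arc`, where
`A = R/(h)` was a hypersurface and the Hilbert–Samuel equality along the arc was COMPUTED): here `A` is any Noetherian local ring and
the equality `H^{(r)}[A_P] = H^{(0)}[A]` along a prime `P` with `A/P` regular of dimension `r` is a HYPOTHESIS — by Bennett's criterion
(tree `isNormallyFlat_iff_hilbertFun_eq_hilbertSamuelFun`, CJS Thm. 3.3 / HIO Thm. (22.24), PROVED) it is the same as «`A` is normally
flat along `P`», which ROUTE G is to obtain from CJS Thm. 3.2 (2)(iv)⇒(i) and the order permanence of a standard base along the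
free-rational tail (G1b-β/γ).

* `hsFun_prime_eq_hsFun_closedPoint_of_hilbertSamuelFun_eq` — for `A` Noetherian local catenary, `P` prime with `dim A/P = r`
  containing every minimal prime of `A` (CJS Lemma 2.30 (2): `I(x) = I(y)`, so `ψ(A) = ψ(A_P) + r`) and `H^{(r)}[A_P] = H^{(0)}[A]`:
  `H^N_{Spec A}(P) = H^N_{Spec A}(𝔪)` for every level `N`.
* `not_isIsolatedInHSMaxLocus_closedPoint_of_hilbertSamuelFun_eq` — if moreover `P ≠ 𝔪`, the closed point of `Spec A` is NOT
  isolated in the Hilbert–Samuel locus.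
* `not_isIsolatedInHSMaxLocus_closedPoint_of_isNormallyFlat` — the same with the hypothesis «`A/P` regular of dimension `r ≥ 1` and
  `A` normally flat along `P`» (Bennett, tree).

[OURS · L1 W4.2] bookkeeping over the tree's Bennett / ψ library; NOT a statement of any source, and NOT a statement of H. Hironaka's
2017 manuscript. AI-written (res-type-001 g8); AI review is weaker than expert review.
-/

set_option linter.dupNamespace false

noncomputable section

open CategoryTheory AlgebraicGeometry TopologicalSpace IsLocalRing
open Literature.AlgebraicGeometry.Resolution Literature.RingTheory.HilbertSamuel
open Literature.AlgebraicGeometry.CossartJannsenSaito2020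

namespace Summit.ResolutionOfSingularities.ResolutionOfSingularities.Theorems.SigmaMaxModificationsCorridor3.IsoTailsHS

universe u

/-- `H^N` at the closed point of `Spec A` is `H^{(N − ψ(A))}(A)`. [cite: CossartJannsenSaito2020, Def. 2.28] -/
theorem hsFun_closedPoint_eq {A : Type u} [CommRing A] [IsNoetherianRing A] [IsLocalRing A] (N : ℕ) :
    Scheme.hsFun (Spec (CommRingCat.of A)) N (closedPoint A) = hilbertSamuelFun A (N - minimalPrimesCodim A) := by
  let e𝔪 : A ≃+* Localization.AtPrime (maximalIdeal A) :=
    (IsLocalization.atUnits A (maximalIdeal A).primeCompl (S := Localization.AtPrime (maximalIdeal A)) (by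
      intro y hy
      exact not_not.mp fun hu => hy ((IsLocalRing.mem_maximalIdeal y).mpr hu))).toRingEquiv
  haveI : IsLocalization.AtPrime (Localization.AtPrime (maximalIdeal A)) (closedPoint A).asIdeal :=
    (inferInstance : IsLocalization.AtPrime (Localization.AtPrime (maximalIdeal A)) (maximalIdeal A))
  rw [hsFun_Spec_eq N (closedPoint A) (Localization.AtPrime (maximalIdeal A)),
    ← Literature.RingTheory.HilbertSamuel.minimalPrimesCodim_eq_of_ringEquiv e𝔪, ← hilbertSamuelFun_eq_of_ringEquiv e𝔪]

/-- **`ψ(A) = ψ(A_P) + dim A/P`** as natural numbers, when every minimal prime of the catenary Noetherian local ring `A` lies in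
`P` (CJS Lemma 2.30 (2), tree `minimalPrimesCodim_eq_localization_add`). [cite: CossartJannsenSaito2020, Lemma 2.30 (2)] -/
theorem minimalPrimesCodim_eq_localization_add_nat {A : Type u} [CommRing A] [IsNoetherianRing A] [IsLocalRing A]
    (hA : IsCatenaryRing A) (P : Ideal A) [P.IsPrime] {r : ℕ} (hr : ringKrullDim (A ⧸ P) = (r : ℕ))
    (hI : ∀ 𝔮 ∈ minimalPrimes A, 𝔮 ≤ P) :
    minimalPrimesCodim A = minimalPrimesCodim (Localization.AtPrime P) + r := by
  have h := minimalPrimesCodim_eq_localization_add A P hA hI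
  rw [hr] at h
  exact_mod_cast h

/-- **The arc point has the Hilbert–Samuel function of the closed point.** Let `A` be a catenary Noetherian local ring, `P` a prime
with `dim A/P = r` containing every minimal prime of `A` (CJS: `I(x) = I(y)`), and assume Bennett's equality
`H^{(r)}[A_P] = H^{(0)}[A]` (equivalently, for `A/P` regular: `A` is normally flat along `P`, CJS Thm. 3.3). Then
`H^N_{Spec A}(P) = H^N_{Spec A}(𝔪)` for every `N`. [cite: CossartJannsenSaito2020, Def. 2.28, Lemma 2.30 (2), Thm. 3.3] -/
theorem hsFun_prime_eq_hsFun_closedPoint_of_hilbertSamuelFun_eq {A : Type u} [CommRing A] [IsNoetherianRing A] [IsLocalRing A]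
    (hA : IsCatenaryRing A) (P : Ideal A) [hP : P.IsPrime] {r : ℕ} (hr : ringKrullDim (A ⧸ P) = (r : ℕ))
    (hI : ∀ 𝔮 ∈ minimalPrimes A, 𝔮 ≤ P)
    (hH : hilbertSamuelFun (Localization.AtPrime P) r = hilbertFun A) {N : ℕ} (hN : minimalPrimesCodim A ≤ N) :
    Scheme.hsFun (Spec (CommRingCat.of A)) N ⟨P, hP⟩ = Scheme.hsFun (Spec (CommRingCat.of A)) N (closedPoint A) := by
  have hψ := minimalPrimesCodim_eq_localization_add_nat hA P hr hI
  rw [hsFun_Spec_eq N (⟨P, hP⟩ : ↥(Spec (CommRingCat.of A))) (Localization.AtPrime P), hsFun_closedPoint_eq, hψ]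
  rw [hψ] at hN
  have h1 : N - minimalPrimesCodim (Localization.AtPrime P) =
      (N - (minimalPrimesCodim (Localization.AtPrime P) + r)) + r := by
    omega
  rw [h1, hilbertSamuelFun, iterPSum_add, ← hilbertSamuelFun, hH]
  rfl

/-- **G1b-α (D14 ROUTE G): THE CLOSED POINT IS NOT ISOLATED IN THE HILBERT–SAMUEL LOCUS** when a proper prime `P ≠ 𝔪` with
`dim A/P = r`, containing every minimal prime, carries Bennett's equality `H^{(r)}[A_P] = H^{(0)}[A]` (levels `N ≥ ψ(A)`): the point
`P` of `Spec A` has the same `H^N` as the closed point, specializes to it and differs from it, so no open set meets the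
Hilbert–Samuel locus in the closed point alone. The embedding-dimension-free twin of H7's
`not_isIsolatedInHSMaxLocus_closedPoint_of_arc`. [OURS · L1 W4.2; AI-written]
[cite: CossartJannsenSaito2020, Def. 2.35, Lemma 2.30 (2), Thm. 3.3] -/
theorem not_isIsolatedInHSMaxLocus_closedPoint_of_hilbertSamuelFun_eq {A : Type u} [CommRing A] [IsNoetherianRing A]
    [IsLocalRing A] (hA : IsCatenaryRing A) (P : Ideal A) [hP : P.IsPrime] (hPm : P ≠ maximalIdeal A) {r : ℕ}
    (hr : ringKrullDim (A ⧸ P) = (r : ℕ)) (hI : ∀ 𝔮 ∈ minimalPrimes A, 𝔮 ≤ P)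
    (hH : hilbertSamuelFun (Localization.AtPrime P) r = hilbertFun A) {N : ℕ} (hN : minimalPrimesCodim A ≤ N) :
    ¬ IsIsolatedInHSMaxLocus (Spec (CommRingCat.of A)) N (closedPoint A) := by
  have hHeq := hsFun_prime_eq_hsFun_closedPoint_of_hilbertSamuelFun_eq hA P hr hI hH hN
  have hne : (⟨P, hP⟩ : ↥(Spec (CommRingCat.of A))) ≠ closedPoint A := fun h =>
    hPm (congrArg PrimeSpectrum.asIdeal h)
  have hspec : (⟨P, hP⟩ : ↥(Spec (CommRingCat.of A))) ⤳ closedPoint A := by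
    rw [← PrimeSpectrum.le_iff_specializes]
    exact IsLocalRing.le_maximalIdeal (Ideal.IsPrime.ne_top hP)
  rintro ⟨U, hU, hUmax⟩
  have h𝔪 : closedPoint A ∈ U ∩ Scheme.hsMaxLocus (Spec (CommRingCat.of A)) N := by
    rw [hUmax]; exact Set.mem_singleton _
  have hPU : (⟨P, hP⟩ : ↥(Spec (CommRingCat.of A))) ∈ U := hspec.mem_open hU h𝔪.1
  have hPmax : (⟨P, hP⟩ : ↥(Spec (CommRingCat.of A))) ∈ Scheme.hsMaxLocus (Spec (CommRingCat.of A)) N := by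
    have h2 : Maximal (· ∈ Scheme.hsValues (Spec (CommRingCat.of A)) N)
        (Scheme.hsFun (Spec (CommRingCat.of A)) N (closedPoint A)) := h𝔪.2
    show Maximal (· ∈ Scheme.hsValues (Spec (CommRingCat.of A)) N) (Scheme.hsFun (Spec (CommRingCat.of A)) N ⟨P, hP⟩)
    rw [hHeq]
    exact h2
  have hmem : (⟨P, hP⟩ : ↥(Spec (CommRingCat.of A))) ∈ ({closedPoint A} : Set ↥(Spec (CommRingCat.of A))) :=
    hUmax ▸ ⟨hPU, hPmax⟩
  exact hne (Set.mem_singleton_iff.mp hmem)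

/-- **G1b-α from NORMAL FLATNESS** (the form ROUTE G produces): `A` catenary Noetherian local, `P` a prime with `A/P` regular of
dimension `r ≥ 1` containing every minimal prime of `A`, and `A` normally flat along `P` (CJS Def. 3.1; Bennett's criterion
`hilbertFun_eq_hilbertSamuelFun_of_isNormallyFlat` turns it into `H^{(0)}[A] = H^{(r)}[A_P]`) ⟹ the closed point of `Spec A` is
NOT isolated in the Hilbert–Samuel locus (levels `N ≥ ψ(A)`). [OURS · L1 W4.2; AI-written]
[cite: CossartJannsenSaito2020, Def. 3.1, Thm. 3.3, Lemma 2.30 (2)] -/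
theorem not_isIsolatedInHSMaxLocus_closedPoint_of_isNormallyFlat {A : Type u} [CommRing A] [IsNoetherianRing A]
    [IsLocalRing A] (hA : IsCatenaryRing A) (P : Ideal A) [P.IsPrime] [IsRegularLocalRing (A ⧸ P)] {r : ℕ} (hr1 : 1 ≤ r)
    (hr : ringKrullDim (A ⧸ P) = (r : ℕ)) (hI : ∀ 𝔮 ∈ minimalPrimes A, 𝔮 ≤ P) (hNF : P.IsNormallyFlat) {N : ℕ}
    (hN : minimalPrimesCodim A ≤ N) :
    ¬ IsIsolatedInHSMaxLocus (Spec (CommRingCat.of A)) N (closedPoint A) := by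
  have hH := (hilbertFun_eq_hilbertSamuelFun_of_isNormallyFlat P (Localization.AtPrime P) hr hNF).symm
  refine not_isIsolatedInHSMaxLocus_closedPoint_of_hilbertSamuelFun_eq hA P ?_ hr hI hH hN
  -- `P ≠ 𝔪`: `A/P` has dimension `r ≥ 1`, `A/𝔪` is a field
  intro heq
  have hdim : ringKrullDim (A ⧸ maximalIdeal A) = (r : ℕ) := heq ▸ hr
  letI := Ideal.Quotient.field (maximalIdeal A)
  rw [ringKrullDim_eq_zero_of_field] at hdim
  have : (r : WithBot ℕ∞) = 0 := by exact_mod_cast hdim.symm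
  have hr0 : r = 0 := by exact_mod_cast this
  omega

end Summit.ResolutionOfSingularities.ResolutionOfSingularities.Theorems.SigmaMaxModificationsCorridor3.IsoTailsHS

end
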